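/-
Origin: written from primary sources — S. Kudla, *Seesaw dual reductive pairs* (1984) §1 (the see-saw pair
`(U(V), U(W₁) × U(W₂))` inside `Sp(V ⊗ (W₁ ⊕ W₂)) = Sp((V ⊗ W₁) ⊕ (V ⊗ W₂))`); C. Mœglin, M.-F. Vignéras,
J.-L. Waldspurger, *Correspondances de Howe sur un corps p-adique* (1987) Chap. 2 II.1 (transport of structure of the
metaplectic group and of the Weil representation along an isomorphism of symplectic spaces); A. Weil, *Sur certains
groupes d'opérateurs unitaires* (1964) Chap. III n° 37–41. Adapted: no. This file is GLUE, the generalisation of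
`AdelicMetaplecticSeesawKronecker` from the Kronecker relabelling `Equiv.prodSumDistrib` to an ARBITRARY decomposition
`e : κ ≃ κ₁ ⊕ κ₂` of the index set along which the Gram matrix splits, `reindex e e T = T₁ ⊕ T₂` (equation
parameter): reindex along `e` (`AdelicMetaplecticReindex`), relabel by `1` along that identity
(`AdelicMetaplecticTransport`), and read the see-saw character of `AdelicMetaplecticSeesawCharacter` in the original
coordinates. It also records the formulas for the INVERSE reindexing of record (consumers' splittings arrive in
enumerated coordinates `Fin n` and must be read back). Kernel only; no records.
-/
import Literature.NumberTheory.Weil1964.AdelicMetaplecticSeesawKronecker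
import HarnessLib

-- buildfix G11b-3 recipe (LEDGER B13-1/B13-3): elaborate sequentially so the trailing `attribute [implicit_reducible]`
-- block (reducibilityCoreExt is keyed to the async environment branch) is in force at `.olean` export.
set_option Elab.async false

/-!
# The see-saw character along a decomposition `e : κ ≃ κ₁ ⊕ κ₂` of the index set

Fix a number field `F`, finite index types `κ, κ₁, κ₂`, a bijection `e : κ ≃ κ₁ ⊕ κ₂` and Gram matrices
`T ∈ M_κ(𝔸_F)`, `T_j ∈ M_{κ_j}(𝔸_F)` with **`hT : reindex e e T = fromBlocks T₁ 0 0 T₂`** (e.g. `κ = n × (m₁ ⊕ m₂)`,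
`e = Equiv.prodSumDistrib`, `T = T_V ⊗ (T₁′ ⊕ T₂′)` — the case of `AdelicMetaplecticSeesawKronecker`; or
`κ = Fin N × Fin (M₁ + M₂)`, `e = finProdSumEquiv N M₁ M₂`, `T = T_V ⊗ (T₁′ ⊕ᶠ T₂′)` — the case of unitary-2's
`UnitaryGroupDirectSumCarriers.reindex_kronecker_finSum`; or `κ = Fin n` enumerated coordinates).

* §0 the inverse reindexing of record `(adelicMpContReindex F e T).symm` — `omega_reindex_symm_apply`
  (`ω_T(reindex⁻¹ q) Φ = R_e⁻¹ (ω(q) (R_e Φ))`), `spReindex_proj_reindex_symm` (`W_e π(reindex⁻¹ q) W_e⁻¹ = π(q)`),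
  `proj_reindex_symm_eq` (hence `π(reindex⁻¹ q) = g` whenever `π(q) = W_e g W_e⁻¹`), `Θ`-fixing
  (`coe_adelicMpContReindex_symm_mem_adelicMpTheta_iff`);
* §1 `sumTransport F e hT : Mp_ψ(W_T)ᶜᵒⁿᵗ ≃* Mp_ψ(W_{T₁ ⊕ T₂})ᶜᵒⁿᵗ` (reindex along `e`, relabel by `1` along `hT`),
  continuous, `Θ`-fixing-preserving, `ω(sumTransport p) Ψ = R_e (ω(p) (R_e⁻¹ Ψ))`, `π(sumTransport p) w = W_e (π(p) (W_e⁻¹ w))`;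
  `sumTensor F e Φ₁ Φ₂ := R_e⁻¹ (Φ₁ ⊠ Φ₂) ∈ 𝒮(𝔸_F^κ)` with its values;
* §2 for `S : P →* Mp_ψ(W_T)ᶜᵒⁿᵗ`, `s_j : P →* Mp_ψ(W_{T_j})ᶜᵒⁿᵗ` with
  `hS : ∀ p, (spReindex e T (π(S p))).1 = (spSum T₁ T₂ (π(s₁ p), π(s₂ p))).1` (see-saw compatibility read through
  `e`, an equality of underlying linear equivalences): `sumSeesawSplitting e hT S := sumTransport ∘ S` satisfies the
  hypothesis of `mpSeesawChar` (`proj_sumSeesawSplitting`), whence **`mpSeesawCharSum e hT S s₁ s₂ hS hT₁ hT₂ : P →* ℂˣ`**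
  with `ω(S p) (sumTensor Φ₁ Φ₂) = χ(p) • sumTensor (ω(s₁ p) Φ₁) (ω(s₂ p) Φ₂)` (`mpSeesawCharSum_spec`), `χ(p) = 1`
  when the three values are `Θ`-fixing (`mpSeesawCharSum_eq_one_of_mem_adelicMpTheta`), and `mpSeesawCharSum_def` so
  that all of `AdelicMetaplecticSeesawCharacter` (twists, product group, continuity) applies to `sumSeesawSplitting`.

Provenance / use (Hodge-CM model-construction cell, node W2-⊗): the splittings of record
(`GelbartRogawski1991/UnitaryDualPairSplittingDatum.pairSplitting`) live over `adelicGram e_VW T_V T_W =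
reindex e_VW e_VW (T_V ⊗ T_W)` on `Fin n`; `(adelicMpContReindex F e_VW _).symm` reads them on `Fin N × Fin M` (§0),
and with `e := finProdSumEquiv N M₁ M₂`, `hT := reindex_kronecker_finSum` the hypothesis `hS` is unitary-2's
`adelicPairToSymplectic_dualPair_adelicBlockDiag` verbatim (after `proj_reindex_symm_eq`). The conjugated `(34)` torus
enters through `AdelicMetaplecticSeesawConjugate.conjSplitting` in the `Fin N × Fin M` coordinates before §2.

Implementation note: symplectic-group-valued objects are typed through `adelicForm`; equalities across
propositionally distinct symplectic groups are stated as `(…).1 = (…).1`; proofs are `rfl`/`.trans` chains (no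
rewriting over the heavy carriers).
-/

set_option autoImplicit false

noncomputable section

open NumberField
open scoped Matrix Classical

namespace Literature.NumberTheory.Weil1964

open Literature.RepresentationTheory.HeisenbergGroup Literature.NumberTheory.Automorphic IsDedekindDomain
open Literature.NumberTheory.Automorphic.UnitaryGroup (spReindex spSum reindexW spReindex_injective)

/-! ## §0 The inverse reindexing of record -/

section ReindexSymm

variable (F : Type) [Field F] [NumberField F] {ι ι' : Type} [Fintype ι] [Fintype ι'] [DecidableEq ι]
  [DecidableEq ι'] (e : ι ≃ ι') (T : Matrix ι ι (AdeleRing (𝓞 F) F))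

/-- **`ω(q) (R_e Φ) = R_e (ω_T(reindex⁻¹ q) Φ)`** for `q ∈ Mp_ψ(W_{reindex e e T})ᶜᵒⁿᵗ`.
[cite: MoeglinVignerasWaldspurger1987, Chap. 2 II.1 (B)] -/
theorem adelicMpCont.omega_apply_piSBReindex (q : adelicMpCont F ι' (Matrix.reindex e e T)) (Φ : piSchwartzBruhat F ι) :
    adelicMpCont.omega F ι' (Matrix.reindex e e T) q (piSBReindex F e Φ) =
      piSBReindex F e (adelicMpCont.omega F ι T ((adelicMpContReindex F e T).symm q) Φ) :=
  ((congrArg (fun x => adelicMpCont.omega F ι' (Matrix.reindex e e T) x (piSBReindex F e Φ))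
      ((adelicMpContReindex F e T).apply_symm_apply q)).symm.trans
    (adelicMpCont.omega_reindex_apply F e T ((adelicMpContReindex F e T).symm q) (piSBReindex F e Φ))).trans
    (congrArg (fun Ψ => piSBReindex F e (adelicMpCont.omega F ι T ((adelicMpContReindex F e T).symm q) Ψ))
      ((piSBReindex F e).symm_apply_apply Φ))

/-- **`ω_T(reindex⁻¹ q) Φ = R_e⁻¹ (ω(q) (R_e Φ))`.** [cite: MoeglinVignerasWaldspurger1987, Chap. 2 II.1 (B)] -/
theorem adelicMpCont.omega_reindex_symm_apply (q : adelicMpCont F ι' (Matrix.reindex e e T)) (Φ : piSchwartzBruhat F ι) :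
    adelicMpCont.omega F ι T ((adelicMpContReindex F e T).symm q) Φ =
      (piSBReindex F e).symm (adelicMpCont.omega F ι' (Matrix.reindex e e T) q (piSBReindex F e Φ)) :=
  ((piSBReindex F e).symm_apply_apply _).symm.trans
    (congrArg (piSBReindex F e).symm (adelicMpCont.omega_apply_piSBReindex F e T q Φ).symm)

/-- **`W_e π_T(reindex⁻¹ q) W_e⁻¹ = π(q)`.** [cite: MoeglinVignerasWaldspurger1987, Chap. 2 II.1 (A)] -/
theorem adelicMpCont.spReindex_proj_reindex_symm (q : adelicMpCont F ι' (Matrix.reindex e e T)) :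
    spReindex e T (adelicMpCont.proj F ι T ((adelicMpContReindex F e T).symm q)) =
      adelicMpCont.proj F ι' (Matrix.reindex e e T) q :=
  (adelicMpCont.proj_reindex F e T ((adelicMpContReindex F e T).symm q)).symm.trans
    (congrArg (adelicMpCont.proj F ι' (Matrix.reindex e e T)) ((adelicMpContReindex F e T).apply_symm_apply q))

/-- **reading `π` back**: if `π(q) = W_e g W_e⁻¹` then `π_T(reindex⁻¹ q) = g` (`spReindex e T` is injective).
[folklore] -/
theorem adelicMpCont.proj_reindex_symm_eq {q : adelicMpCont F ι' (Matrix.reindex e e T)}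
    {g : symplecticGroup (polar (adelicForm F ι T))}
    (h : adelicMpCont.proj F ι' (Matrix.reindex e e T) q = spReindex e T g) :
    adelicMpCont.proj F ι T ((adelicMpContReindex F e T).symm q) = g :=
  spReindex_injective e T ((adelicMpCont.spReindex_proj_reindex_symm F e T q).trans h)

/-- `Θ`-fixing along the inverse reindexing of record. [cite: Weil1964, Chap. III n° 41 Thm 6 p. 193] -/
theorem coe_adelicMpContReindex_symm_mem_adelicMpTheta_iff (q : adelicMpCont F ι' (Matrix.reindex e e T)) :
    (((adelicMpContReindex F e T).symm q : adelicMpCont F ι T) : adelicMp F ι T) ∈ adelicMpTheta F ι T ↔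
      (q : adelicMp F ι' (Matrix.reindex e e T)) ∈ adelicMpTheta F ι' (Matrix.reindex e e T) :=
  (coe_adelicMpContReindex_mem_adelicMpTheta_iff F e T ((adelicMpContReindex F e T).symm q)).symm.trans
    (by rw [MulEquiv.apply_symm_apply])

end ReindexSymm

/-! ## §1 The transport `Mp_ψ(W_T)ᶜᵒⁿᵗ ≃* Mp_ψ(W_{T₁ ⊕ T₂})ᶜᵒⁿᵗ` along `e` -/

section Transport

variable (F : Type) [Field F] [NumberField F] {κ κ₁ κ₂ : Type} [Fintype κ] [DecidableEq κ] [Fintype κ₁]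
  [DecidableEq κ₁] [Fintype κ₂] [DecidableEq κ₂] (e : κ ≃ κ₁ ⊕ κ₂)
  {T : Matrix κ κ (AdeleRing (𝓞 F) F)} {T₁ : Matrix κ₁ κ₁ (AdeleRing (𝓞 F) F)} {T₂ : Matrix κ₂ κ₂ (AdeleRing (𝓞 F) F)}
  (hT : Matrix.reindex e e T = Matrix.fromBlocks T₁ 0 0 T₂)

omit [Fintype κ] [DecidableEq κ] in
include hT in
/-- **`(T₁ ⊕ T₂) · 1 = reindex_e T`** — the matrix identity along which the relabelling of record (with `C = 1`)
is taken. [folklore] -/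
theorem fromBlocks_mul_one_eq_reindex :
    Matrix.fromBlocks T₁ 0 0 T₂ *
        ((1 : GL (κ₁ ⊕ κ₂) (AdeleRing (𝓞 F) F)) : Matrix (κ₁ ⊕ κ₂) (κ₁ ⊕ κ₂) (AdeleRing (𝓞 F) F)) =
      Matrix.reindex e e T := by
  rw [Units.val_one, Matrix.mul_one, hT]

/-- **THE TRANSPORT TO SUM COORDINATES** `Mp_ψ(W_T)ᶜᵒⁿᵗ ≃* Mp_ψ(W_{T₁ ⊕ T₂})ᶜᵒⁿᵗ`: reindex along `e`, then relabel
(with `C = 1`) along `fromBlocks_mul_one_eq_reindex`. [cite: MoeglinVignerasWaldspurger1987, Chap. 2 II.1 (A)–(B)] -/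
def sumTransport : adelicMpCont F κ T ≃* adelicMpCont F (κ₁ ⊕ κ₂) (Matrix.fromBlocks T₁ 0 0 T₂) :=
  (adelicMpContReindex F e T).trans
    (adelicMpContRelabel F (κ₁ ⊕ κ₂) 1 (fromBlocks_mul_one_eq_reindex F e hT))

/-- Unfolding: `sumTransport p = relabel₁ (reindex_e p)`. [folklore] -/
theorem sumTransport_apply (p : adelicMpCont F κ T) :
    sumTransport F e hT p =
      adelicMpContRelabel F (κ₁ ⊕ κ₂) 1 (fromBlocks_mul_one_eq_reindex F e hT) (adelicMpContReindex F e T p) :=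
  rfl

/-- **The transport is continuous** (coefficient topologies). [cite: Weil1964, Chap. III n° 39 p. 189] -/
theorem continuous_sumTransport : Continuous (sumTransport F e hT) :=
  (continuous_adelicMpContRelabel F _ 1 (fromBlocks_mul_one_eq_reindex F e hT)).comp
    (continuous_adelicMpContReindex F _ _)

/-- **The transport preserves `Θ`-fixing.** [cite: Weil1964, Chap. III n° 41 Thm 6 p. 193] -/
theorem sumTransport_mem_adelicMpTheta_iff (p : adelicMpCont F κ T) :
    ((sumTransport F e hT p : adelicMpCont F (κ₁ ⊕ κ₂) (Matrix.fromBlocks T₁ 0 0 T₂)) :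
          adelicMp F (κ₁ ⊕ κ₂) (Matrix.fromBlocks T₁ 0 0 T₂)) ∈
        adelicMpTheta F (κ₁ ⊕ κ₂) (Matrix.fromBlocks T₁ 0 0 T₂) ↔
      (p : adelicMp F κ T) ∈ adelicMpTheta F κ T :=
  (coe_adelicMpContRelabel_mem_adelicMpTheta_iff F (κ₁ ⊕ κ₂) 1 (fromBlocks_mul_one_eq_reindex F e hT)
      (adelicMpContReindex F e T p)).trans
    (coe_adelicMpContReindex_mem_adelicMpTheta_iff F _ _ p)

/-- **The Weil representation after transport is the reindexed one**: `ω(sumTransport p) Ψ = R_e (ω(p) (R_e⁻¹ Ψ))`.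
[cite: MoeglinVignerasWaldspurger1987, Chap. 2 II.1 (B)] -/
theorem omega_sumTransport_apply (p : adelicMpCont F κ T) (Ψ : piSchwartzBruhat F (κ₁ ⊕ κ₂)) :
    adelicMpCont.omega F (κ₁ ⊕ κ₂) (Matrix.fromBlocks T₁ 0 0 T₂) (sumTransport F e hT p) Ψ =
      piSBReindex F e (adelicMpCont.omega F κ T p ((piSBReindex F e).symm Ψ)) :=
  (LinearMap.congr_fun (adelicMpCont.omega_relabel F (κ₁ ⊕ κ₂) 1 (fromBlocks_mul_one_eq_reindex F e hT)
      (adelicMpContReindex F e T p)) Ψ).trans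
    (adelicMpCont.omega_reindex_apply F _ _ p Ψ)

/-- **The projection after transport is `W_e π(p) W_e⁻¹`**, pointwise: `π(sumTransport p) w = W_e (π(p) (W_e⁻¹ w))`.
[cite: MoeglinVignerasWaldspurger1987, Chap. 2 II.1 (A)] -/
theorem coe_proj_sumTransport_apply (p : adelicMpCont F κ T)
    (w : ((κ₁ ⊕ κ₂) → AdeleRing (𝓞 F) F) × ((κ₁ ⊕ κ₂) → AdeleRing (𝓞 F) F)) :
    ((adelicMpCont.proj F (κ₁ ⊕ κ₂) (Matrix.fromBlocks T₁ 0 0 T₂) (sumTransport F e hT p) :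
        symplecticGroup (polar (adelicForm F (κ₁ ⊕ κ₂) (Matrix.fromBlocks T₁ 0 0 T₂)))) :
        (((κ₁ ⊕ κ₂) → AdeleRing (𝓞 F) F) × ((κ₁ ⊕ κ₂) → AdeleRing (𝓞 F) F)) ≃ₗ[AdeleRing (𝓞 F) F]
          (((κ₁ ⊕ κ₂) → AdeleRing (𝓞 F) F) × ((κ₁ ⊕ κ₂) → AdeleRing (𝓞 F) F))) w =
      reindexW (AdeleRing (𝓞 F) F) e
        (((adelicMpCont.proj F κ T p : symplecticGroup (polar (adelicForm F κ T))) :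
            ((κ → AdeleRing (𝓞 F) F) × (κ → AdeleRing (𝓞 F) F)) ≃ₗ[AdeleRing (𝓞 F) F]
              ((κ → AdeleRing (𝓞 F) F) × (κ → AdeleRing (𝓞 F) F)))
          ((reindexW (AdeleRing (𝓞 F) F) e).symm w)) :=
  (coe_proj_adelicMpRelabel_one_apply F (fromBlocks_mul_one_eq_reindex F e hT)
      (adelicMpReindex F e T p) w).trans
    (coe_proj_adelicMpReindex_apply F e T p w)

end Transport

/-! ### The external tensor read through `e` -/

section SumTensor

variable (F : Type) [Field F] [NumberField F] {κ κ₁ κ₂ : Type} [Fintype κ] [Fintype κ₁] [Fintype κ₂]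
  (e : κ ≃ κ₁ ⊕ κ₂)

/-- **`Φ₁ ⊠ Φ₂` read in the original coordinates**: `R_e⁻¹ (Φ₁ ⊠ Φ₂) ∈ 𝒮(𝔸_F^κ)`. [folklore] -/
def sumTensor (Φ₁ : piSchwartzBruhat F κ₁) (Φ₂ : piSchwartzBruhat F κ₂) : piSchwartzBruhat F κ :=
  (piSBReindex F e).symm (tensorToSum F κ₁ κ₂ Φ₁ Φ₂)

/-- Unfolding. [folklore] -/
theorem sumTensor_def (Φ₁ : piSchwartzBruhat F κ₁) (Φ₂ : piSchwartzBruhat F κ₂) :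
    sumTensor F e Φ₁ Φ₂ = (piSBReindex F e).symm (tensorToSum F κ₁ κ₂ Φ₁ Φ₂) :=
  rfl

/-- `R_e (sumTensor Φ₁ Φ₂) = Φ₁ ⊠ Φ₂`. [folklore] -/
@[simp] theorem piSBReindex_sumTensor (Φ₁ : piSchwartzBruhat F κ₁) (Φ₂ : piSchwartzBruhat F κ₂) :
    piSBReindex F e (sumTensor F e Φ₁ Φ₂) = tensorToSum F κ₁ κ₂ Φ₁ Φ₂ :=
  (piSBReindex F e).apply_symm_apply _

/-- **Values**: `(sumTensor Φ₁ Φ₂)(w) = Φ₁ (fun i => w (e⁻¹ (inl i))) · Φ₂ (fun k => w (e⁻¹ (inr k)))`. [folklore] -/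
theorem coe_sumTensor_apply (Φ₁ : piSchwartzBruhat F κ₁) (Φ₂ : piSchwartzBruhat F κ₂)
    (w : κ → AdeleRing (𝓞 F) F) :
    (sumTensor F e Φ₁ Φ₂ : (κ → AdeleRing (𝓞 F) F) → ℂ) w =
      (Φ₁ : (κ₁ → AdeleRing (𝓞 F) F) → ℂ) (fun i => w (e.symm (Sum.inl i))) *
        (Φ₂ : (κ₂ → AdeleRing (𝓞 F) F) → ℂ) (fun k => w (e.symm (Sum.inr k))) := by
  rw [sumTensor_def, coe_piSBReindex_symm_apply, coe_tensorToSum, boxTensor_apply]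
  rfl

/-- `sumTensor` is additive in the first slot. [folklore] -/
theorem sumTensor_add_left (Φ₁ Φ₁' : piSchwartzBruhat F κ₁) (Φ₂ : piSchwartzBruhat F κ₂) :
    sumTensor F e (Φ₁ + Φ₁') Φ₂ = sumTensor F e Φ₁ Φ₂ + sumTensor F e Φ₁' Φ₂ := by
  rw [sumTensor_def, sumTensor_def, sumTensor_def, map_add, LinearMap.add_apply, map_add]

/-- `sumTensor` is additive in the second slot. [folklore] -/
theorem sumTensor_add_right (Φ₁ : piSchwartzBruhat F κ₁) (Φ₂ Φ₂' : piSchwartzBruhat F κ₂) :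
    sumTensor F e Φ₁ (Φ₂ + Φ₂') = sumTensor F e Φ₁ Φ₂ + sumTensor F e Φ₁ Φ₂' := by
  rw [sumTensor_def, sumTensor_def, sumTensor_def, map_add, map_add]

/-- `sumTensor` is homogeneous in each slot. [folklore] -/
theorem sumTensor_smul (c d : ℂ) (Φ₁ : piSchwartzBruhat F κ₁) (Φ₂ : piSchwartzBruhat F κ₂) :
    sumTensor F e (c • Φ₁) (d • Φ₂) = (c * d) • sumTensor F e Φ₁ Φ₂ := by
  simp only [sumTensor_def, map_smul, LinearMap.smul_apply, smul_smul, mul_comm d c]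

end SumTensor

/-! ## §2 The see-saw character read through `e` -/

section Seesaw

variable {F : Type} [Field F] [NumberField F] {κ κ₁ κ₂ : Type} [Fintype κ] [DecidableEq κ] [Fintype κ₁]
  [DecidableEq κ₁] [Fintype κ₂] [DecidableEq κ₂] (e : κ ≃ κ₁ ⊕ κ₂)
  {T : Matrix κ κ (AdeleRing (𝓞 F) F)} {T₁ : Matrix κ₁ κ₁ (AdeleRing (𝓞 F) F)} {T₂ : Matrix κ₂ κ₂ (AdeleRing (𝓞 F) F)}
  (hT : Matrix.reindex e e T = Matrix.fromBlocks T₁ 0 0 T₂)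
  {P : Type*} [Group P]
  (S : P →* adelicMpCont F κ T) (s₁ : P →* adelicMpCont F κ₁ T₁) (s₂ : P →* adelicMpCont F κ₂ T₂)

/-- **The sum-coordinate splitting** `sumTransport ∘ S : P →* Mp(W_{T₁ ⊕ T₂})ᶜᵒⁿᵗ`. [folklore] -/
def sumSeesawSplitting : P →* adelicMpCont F (κ₁ ⊕ κ₂) (Matrix.fromBlocks T₁ 0 0 T₂) :=
  (sumTransport F e hT).toMonoidHom.comp S

/-- Unfolding. [folklore] -/
@[simp] theorem sumSeesawSplitting_apply (p : P) : sumSeesawSplitting e hT S p = sumTransport F e hT (S p) := rfl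

/-- The sum-coordinate splitting is continuous along a continuous `S`. [folklore] -/
theorem continuous_sumSeesawSplitting [TopologicalSpace P] (hc : Continuous S) :
    Continuous (sumSeesawSplitting e hT S) :=
  (continuous_sumTransport F e hT).comp hc

/-- `Θ`-fixing values are preserved. [cite: Weil1964, Chap. III n° 41 Thm 6 p. 193] -/
theorem sumSeesawSplitting_mem_adelicMpTheta_iff (p : P) :
    ((sumSeesawSplitting e hT S p : adelicMpCont F (κ₁ ⊕ κ₂) (Matrix.fromBlocks T₁ 0 0 T₂)) :
          adelicMp F (κ₁ ⊕ κ₂) (Matrix.fromBlocks T₁ 0 0 T₂)) ∈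
        adelicMpTheta F (κ₁ ⊕ κ₂) (Matrix.fromBlocks T₁ 0 0 T₂) ↔
      (S p : adelicMp F κ T) ∈ adelicMpTheta F κ T :=
  sumTransport_mem_adelicMpTheta_iff F e hT (S p)

/-- `ω(sumSeesawSplitting S p) Ψ = R_e (ω(S p) (R_e⁻¹ Ψ))`. [cite: MoeglinVignerasWaldspurger1987, Chap. 2 II.1 (B)] -/
theorem omega_sumSeesawSplitting_apply (p : P) (Ψ : piSchwartzBruhat F (κ₁ ⊕ κ₂)) :
    adelicMpCont.omega F (κ₁ ⊕ κ₂) (Matrix.fromBlocks T₁ 0 0 T₂) (sumSeesawSplitting e hT S p) Ψ =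
      piSBReindex F e (adelicMpCont.omega F κ T (S p) ((piSBReindex F e).symm Ψ)) :=
  omega_sumTransport_apply F e hT (S p) Ψ

/-- `π(sumSeesawSplitting S p) w = W_e (π(S p) (W_e⁻¹ w))`. [cite: MoeglinVignerasWaldspurger1987, Chap. 2 II.1 (A)] -/
theorem coe_proj_sumSeesawSplitting_apply (p : P)
    (w : ((κ₁ ⊕ κ₂) → AdeleRing (𝓞 F) F) × ((κ₁ ⊕ κ₂) → AdeleRing (𝓞 F) F)) :
    ((adelicMpCont.proj F (κ₁ ⊕ κ₂) (Matrix.fromBlocks T₁ 0 0 T₂) (sumSeesawSplitting e hT S p) :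
        symplecticGroup (polar (adelicForm F (κ₁ ⊕ κ₂) (Matrix.fromBlocks T₁ 0 0 T₂)))) :
        (((κ₁ ⊕ κ₂) → AdeleRing (𝓞 F) F) × ((κ₁ ⊕ κ₂) → AdeleRing (𝓞 F) F)) ≃ₗ[AdeleRing (𝓞 F) F]
          (((κ₁ ⊕ κ₂) → AdeleRing (𝓞 F) F) × ((κ₁ ⊕ κ₂) → AdeleRing (𝓞 F) F))) w =
      reindexW (AdeleRing (𝓞 F) F) e
        (((adelicMpCont.proj F κ T (S p) : symplecticGroup (polar (adelicForm F κ T))) :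
            ((κ → AdeleRing (𝓞 F) F) × (κ → AdeleRing (𝓞 F) F)) ≃ₗ[AdeleRing (𝓞 F) F]
              ((κ → AdeleRing (𝓞 F) F) × (κ → AdeleRing (𝓞 F) F)))
          ((reindexW (AdeleRing (𝓞 F) F) e).symm w)) :=
  coe_proj_sumTransport_apply F e hT (S p) w

variable
  (hS : ∀ p : P,
    (spReindex e T (adelicMpCont.proj F κ T (S p))).1 =
      (spSum T₁ T₂ (adelicMpCont.proj F κ₁ T₁ (s₁ p), adelicMpCont.proj F κ₂ T₂ (s₂ p))).1)
  (hT₁ : IsUnit T₁) (hT₂ : IsUnit T₂)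

include hS in
/-- **The hypothesis `hs` of `mpSeesawChar` holds for the sum-coordinate splitting**:
`π(sumSeesawSplitting S p) = π(s₁ p) ⊕ π(s₂ p)`. [cite: Kudla1984, §1] -/
theorem proj_sumSeesawSplitting (p : P) :
    adelicMpCont.proj F (κ₁ ⊕ κ₂) (Matrix.fromBlocks T₁ 0 0 T₂) (sumSeesawSplitting e hT S p) =
      spSum T₁ T₂ (adelicMpCont.proj F κ₁ T₁ (s₁ p), adelicMpCont.proj F κ₂ T₂ (s₂ p)) :=
  Subtype.ext (LinearEquiv.ext fun w =>
    (coe_proj_sumSeesawSplitting_apply e hT S p w).trans (LinearEquiv.congr_fun (hS p) w))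

/-- **THE SEE-SAW CHARACTER READ THROUGH `e`** `χ : P →* ℂˣ` — `mpSeesawChar` of the sum-coordinate splitting
`sumSeesawSplitting e hT S` against `s₁, s₂`. (cf. R. Howe (1979) §3; S. Kudla (1984) §1) [folklore] -/
def mpSeesawCharSum : P →* ℂˣ :=
  mpSeesawChar (sumSeesawSplitting e hT S) s₁ s₂ (proj_sumSeesawSplitting e hT S s₁ s₂ hS) hT₁ hT₂

/-- By definition `mpSeesawCharSum e hT S s₁ s₂ = mpSeesawChar (sumSeesawSplitting e hT S) s₁ s₂` — so every
statement of `AdelicMetaplecticSeesawCharacter` applies to it. [folklore] -/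
theorem mpSeesawCharSum_def :
    mpSeesawCharSum e hT S s₁ s₂ hS hT₁ hT₂ =
      mpSeesawChar (sumSeesawSplitting e hT S) s₁ s₂ (proj_sumSeesawSplitting e hT S s₁ s₂ hS) hT₁ hT₂ :=
  rfl

/-- **The defining identity in sum coordinates**:
`R_e (ω(S p) (R_e⁻¹ (Φ₁ ⊠ Φ₂))) = χ(p) • (ω(s₁ p) Φ₁ ⊠ ω(s₂ p) Φ₂)`. [folklore] -/
theorem mpSeesawCharSum_spec' (p : P) (Φ₁ : piSchwartzBruhat F κ₁) (Φ₂ : piSchwartzBruhat F κ₂) :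
    piSBReindex F e (adelicMpCont.omega F κ T (S p) (sumTensor F e Φ₁ Φ₂)) =
      (mpSeesawCharSum e hT S s₁ s₂ hS hT₁ hT₂ p : ℂ) •
        tensorToSum F κ₁ κ₂ (adelicMpCont.omega F κ₁ T₁ (s₁ p) Φ₁) (adelicMpCont.omega F κ₂ T₂ (s₂ p) Φ₂) :=
  (omega_sumSeesawSplitting_apply e hT S p (tensorToSum F κ₁ κ₂ Φ₁ Φ₂)).symm.trans
    (mpSeesawChar_spec (sumSeesawSplitting e hT S) s₁ s₂ (proj_sumSeesawSplitting e hT S s₁ s₂ hS) hT₁ hT₂ p Φ₁ Φ₂)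

/-- **THE DEFINING IDENTITY IN THE ORIGINAL COORDINATES**:
`ω(S p) (sumTensor Φ₁ Φ₂) = χ(p) • sumTensor (ω(s₁ p) Φ₁) (ω(s₂ p) Φ₂)`. [folklore] -/
theorem mpSeesawCharSum_spec (p : P) (Φ₁ : piSchwartzBruhat F κ₁) (Φ₂ : piSchwartzBruhat F κ₂) :
    adelicMpCont.omega F κ T (S p) (sumTensor F e Φ₁ Φ₂) =
      (mpSeesawCharSum e hT S s₁ s₂ hS hT₁ hT₂ p : ℂ) •
        sumTensor F e (adelicMpCont.omega F κ₁ T₁ (s₁ p) Φ₁) (adelicMpCont.omega F κ₂ T₂ (s₂ p) Φ₂) :=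
  (((piSBReindex F e).symm_apply_apply _).symm.trans
    (congrArg (piSBReindex F e).symm (mpSeesawCharSum_spec' e hT S s₁ s₂ hS hT₁ hT₂ p Φ₁ Φ₂))).trans
    (LinearEquiv.map_smul _ _ _)

/-- **`χ(p) = 1` when the three values are `Θ`-fixing** (rational points). [cite: Weil1964, Chap. III n° 41 Thm 6 p. 193] -/
theorem mpSeesawCharSum_eq_one_of_mem_adelicMpTheta {p : P}
    (hp : (S p : adelicMp F κ T) ∈ adelicMpTheta F κ T)
    (hp₁ : (s₁ p : adelicMp F κ₁ T₁) ∈ adelicMpTheta F κ₁ T₁)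
    (hp₂ : (s₂ p : adelicMp F κ₂ T₂) ∈ adelicMpTheta F κ₂ T₂) :
    mpSeesawCharSum e hT S s₁ s₂ hS hT₁ hT₂ p = 1 :=
  mpSeesawChar_eq_one_of_mem_adelicMpTheta _ _ _ _ hT₁ hT₂
    ((sumSeesawSplitting_mem_adelicMpTheta_iff e hT S p).2 hp) hp₁ hp₂

/-- **Continuity** along continuous `S, s₁, s₂` (coefficient topologies). [cite: Weil1964, Chap. III n° 39 p. 189] -/
theorem continuous_mpSeesawCharSum [TopologicalSpace P] (hc : Continuous S) (hc₁ : Continuous s₁)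
    (hc₂ : Continuous s₂) : Continuous fun p : P => (mpSeesawCharSum e hT S s₁ s₂ hS hT₁ hT₂ p : ℂ) :=
  continuous_mpSeesawChar _ _ _ _ hT₁ hT₂ (continuous_sumSeesawSplitting e hT S hc) hc₁ hc₂

end Seesaw

/-! ### Build-lane note (ops-buildfix G11b-3 recipe, LEDGER B13-1, 2026-08-21)
`lean -o` (the hub build lane, never `lean`/the gate check) runs Lean 4.32's library-suggestion indexers
(`Lean.LibrarySuggestions.SymbolFrequency` / `SineQuaNon`, from their `exportEntriesFn`) over the statement of
every local theorem that is not a denied premise; on this family's statements (very large dependent binder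
telescopes through the theta-kernel / dual-pair data) that fold runs for tens of minutes to hours and the build
lane kills the job (incident G11b-3, run/shared/lean/ops/buildfix/G11b-3-DOSSIER.md). `isDeniedPremise` skips
`[implicit_reducible]` constants before any fold, and a reducibility status on a *theorem* is inert (Meta never
unfolds `thmInfo`; the kernel ignores the attribute), so the public theorems of this file are tagged
`[implicit_reducible]` purely to keep them out of that index. Only other effect: they are not offered by
`+suggestions` premise selectors. No statement or proof is changed; superseded if the operator lands a
deny-list form (`HarnessLib.PremiseIndex`). -/
set_option allowUnsafeReducibility true in
attribute [implicit_reducible]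
  adelicMpCont.omega_apply_piSBReindex adelicMpCont.omega_reindex_symm_apply
  adelicMpCont.spReindex_proj_reindex_symm adelicMpCont.proj_reindex_symm_eq
  coe_adelicMpContReindex_symm_mem_adelicMpTheta_iff fromBlocks_mul_one_eq_reindex
  sumTransport_apply continuous_sumTransport sumTransport_mem_adelicMpTheta_iff
  omega_sumTransport_apply coe_proj_sumTransport_apply sumTensor_def piSBReindex_sumTensor
  coe_sumTensor_apply sumTensor_add_left sumTensor_add_right sumTensor_smul
  sumSeesawSplitting_apply continuous_sumSeesawSplitting sumSeesawSplitting_mem_adelicMpTheta_iff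
  omega_sumSeesawSplitting_apply coe_proj_sumSeesawSplitting_apply proj_sumSeesawSplitting
  mpSeesawCharSum_def mpSeesawCharSum_spec' mpSeesawCharSum_spec
  mpSeesawCharSum_eq_one_of_mem_adelicMpTheta continuous_mpSeesawCharSum

end Literature.NumberTheory.Weil1964

end
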